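import Literature.MathematicalPhysics.QuantumFieldTheory.Balaban1983to89.B9Thm37GpTorusRegular
import Literature.MathematicalPhysics.QuantumFieldTheory.Balaban1983to89.B9Thm39Sum

/-!
# `Balaban1983to89.B9Thm39CinvTorusRegular` — [Balaban1985BackgroundPropagators] THEOREM 3.9 pp. 411–413 ⇒ THEOREM 3.2 (3.48) p. 398 FOR
# `C(U) = (Q′G′²Q′*)⁻¹(U)` AT A GENERAL (REGULAR) CONFIGURATION, AT def-Y's CARRIERS: the (3.95)/(3.96) glue in real coordinates on the block
# carrier `BlkY i × ι` (cell `lit-balaban`, G-B9-LETTERS module M5.6 FILE 1, seat p21 gen 31; lead g30 GO 2026-08-28 05:42Z)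

statement-level skeleton of published theorems with citation tags; proofs where landed; nothing here is a claim about the Yang–Mills mass gap

CITATION HEADER (lean-in-tree rule).  B9 = T. Bałaban, *Propagators for lattice gauge theories in a background field*, Commun. Math. Phys. **99** (1985)
389–434 (journal page = PDF page + 388).  p. 409 (3.87) «C₀ = Σ_{□∈𝒟} h_□C_□h_□», «C_□(U) = (Q′(U)G′²_□(U)Q′*(U))⁻¹ … satisfy all the inequalities of
Theorems 3.1–3.3»; p. 411 (3.95) «Q′G′²Q′*C₀ = I + Σ_□(1 − □̃)Q′G′²Q′*h_□C_□h_□ + Σ_□ □̃Q′(G′² − G′²_□)Q′*h_□C_□h_□ + Σ_□[□̃Q′G′²_□Q′*, h_□]C_□h_□ = I − R»,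
«By the same estimates as in [4], especially (2.83)–(2.85), we can see that the operator R is small and (Q′G′²Q′*)⁻¹ = C₀(I − R)⁻¹ = Σ_{n=0}^∞ C₀Rⁿ (3.96).
The series is convergent in the weighted supremum norm on 𝔅 appearing in the inequality (3.48)»; p. 413 Theorem 3.9 «For M sufficiently large … This
theorem implies Theorem 3.2»; p. 398 Theorem 3.2 (3.48) «|(Q′(U)G′²(U)Q′*(U))⁻¹(y, y′)| ≦ B₀(Lʲη)⁻⁴(L^{j′}η)^{−d}e^{−δ₀d(y,y′)}, y, y′ ∈ 𝔅».
[4] = [Balaban1984PropagatorsII] Lemma 2.1 (2.61) p. 234, (2.64)–(2.66) p. 234, (2.51)–(2.52) p. 232, Prop. 2.3 (2.85)–(2.87) p. 238.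
Rows B9.Thm3.9 × B9.Thm3.2 × B9.Eq3.95 × B9.Eq3.96 × B9.Eq3.87 (cells only; no row head changes).

WHY THIS FILE (G-B9-LETTERS M5.6, r06's `B9-LETTERS-MAP.md` §4).  M5.5 (`B9Thm37GpTorusRegular*`, 9 files) delivered Theorem 3.1's block (3.42) for
`G′(U)` at a general regular `U` from the cube letters.  M5.6 is the twin for the block-sector letter `C(U) = (Q′G′²Q′*)⁻¹(U)` (def-Y `XinvY`, the
`Ring.inverse` of `XY = Q′G′G′Q′*`): Theorem 3.2's kernel bound (3.48) at a general `U` by the printed route (3.95)/(3.96).  r06's `B9Thm39Sum` kernel-checks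
that route on SCALAR functions on 𝔅 with the identity block map; `C(U)` acts on `𝔸`-valued block functions, so THIS FILE re-runs the glue in real
coordinates (`conj b`, [4] (2.52)) on the carrier `BlkY i × ι` with the block map `(s, j) ↦ ιB s` (M5.5 FILE 1's frame), every hypothesis DISPLAYED in
the printed shape and discharged by the later files of the module (F2 first sum (2.83), F3 the upper majorant of `Q′G′²Q′*`, F4 the (3.97) difference
term, F5 the commutator term, F6 assembly at the cube cover of record).

WHAT IS PROVED (all `theorem`s, 0 `def`, 0 sorry, 0 new named facts).
* §1 algebra: `fixedPoint_of_inv_395` (`TL = 1`, `LC₀ = 1 − R` ⇒ `T = C₀ + TR` — (3.96) in fixed-point form, no series), `conj_add`, `conj_scaled_fixedPoint`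
  (the same after `conj b` with a scale weight `s`), `conj_cutMulY` (a real cut-off on ANY carrier is r06's `mulOp` in coordinates), `sum_cutMulY_sq`
  (`Σ_□ h_□² = 1` ⇒ `Σ_□ M_{h_□}M_{h_□} = 1`), `eq395_cutoffs` ((3.95) = r06's ring identity `eq395_oneSub` at cut-off letters).
* §2 ★★ `hasMajorant_conj_Cinv_of_395` — THE GLUE: `TL = 1`, `LC₀ = 1 − R`, block majorants `A·P(a)e^{−r·d}` of `conj b (s•C₀)` and `θe^{−r·d}` of
  `conj b R`, [4] Lemma 2.1 at `(r, α′)`, `θc₁ < 1` ⟹ `conj b (s•T)` has the majorant `A·c₁(1 − θc₁)⁻¹·P(a)·e^{−(1−α′)r·d}` (pv08's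
  `majorant_of_fixedPoint_266`; = r06's `inverse_of_395` without its maximum-principle step — the inverse is GIVEN here, as def-Y's `Ring.inverse`).
* §3 ★ `hasMajorant_conj_C0_of_cubes` — `C₀ = Σ_□ M_{h_□}C_□M_{h_□}` inherits the localized (3.48)-majorants of the cube letters (overlap ≤ N): r06's
  `c0_majorant` at a general block map;  `hasMajorant_three` — the three sums add up (`θ = θ₁ + θ₂ + θ₃`).
* §4 ★★ `hasMajorant_conj_Cinv_of_cubes` — §2 + §3: from the per-cube (3.48) blocks, the three (2.85)-shape majorants and the two identities, the
  (3.48)-shape majorant of `conj b (s•C(U))` with constant `N·A·c₁(1 − (θ₁+θ₂+θ₃)c₁)⁻¹` and rate `(1−α′)r`.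
* §5 ★ `norm_apply_le_of_hasMajorant_blk` — the block-carrier reading ([4] (2.51)): a majorant of `conj b T` bounds `‖(Tλ)(s)‖` for every source `λ`
  supported at one block `s′`, by `(Σ_j‖b_j‖)·K(ιB s, ιB s′)·M₂·|λ|`;  ★★ `norm_Cinv_apply_le_of_cubes` — (3.48)'s printed shape for `T` pointwise.

HONEST SCOPE / NOT CLAIMED.  Theorem 3.9's expansion (3.98) over generalized walks `R′_α(X)` and its locality clause («depends on U restricted to
X̃⁵₀ ∪ …») are NOT reproduced — (3.48) needs only (3.96)'s fixed-point form; the smallness of `R` («the operator R is small», by reference to [4]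
(2.83)–(2.85) and to [2] for (3.97)) is the DISPLAYED hypothesis `hR`/`hR₁,₂,₃` here (files F2–F5 of the module); the per-cube (3.48) blocks `hC` are
Cor. 3.6 for the cube letters `C_□` (M5.1c part 2 / M5.2-E); the local inverse property `hloc` is (3.87)'s «C_□ = (Q′G′²_□Q′*)⁻¹» where `h_□` lives;
`TL = 1` is def-Y's `Ring.inverse` law where `XY` is a unit (w1's `isUnit_XY_parSymY` at the member).  The weight `P` and the scale `s` are
parameters (print: `P(y) = (Lʲη)⁻⁴`, `s = η⁻⁴` in def-Y's lattice units).  Sup-entry (3.48) only (no Hölder/L² line).  Finite 𝕋 member of the k-level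
V1 family; constants explicit; nothing continuum, nothing about the mass gap.  NOT summit progress.

RELATED, NOT DUPLICATED (searched 2026-08-28: `lean search 'Cinv_of_395|conj_Cinv|CinvTorusRegular' --decl` = ∅): r06 `B9Thm39Sum` (scalar, identity
block map; its `eq395_oneSub` USED BY NAME), pv08 `B6RandomWalk.majorant_of_fixedPoint_266`, r06 `B9Thm37Sum.hasMajorant_localSum`/`hasMajorant_sandwich_local`,
M5.5 FILE 1 `B9Thm37GpTorusRegular` (`conj_*`), D2 `B9CubeLettersInvWriteDict.norm_apply_le_of_hasMajorant_testY` (site carrier; §5 is its block twin),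
dag-n06-j/w1 `B9Thm32SiteCVariationalY` (the variational road (V1)–(V4) to (3.48) in cell pub-ymgap — a different proof, not used here).
-/

noncomputable section

namespace Literature.MathematicalPhysics.QuantumFieldTheory.Balaban1983to89.B9Thm39CinvTorusRegular

open Node00 B9CubeLettersInvReadings
open B6Ineq2142KLevelV1 (β)
open B6KLevelCensusIndexV1 (KIdx)
open B6RandomWalk (HasMajorant BlockSupp Triangle254 Ineq261 Ineq263 hasMajorant_mono hasMajorant_add majorant_of_fixedPoint_266)
open B9Thm34Ext (toB6)
open B9GeoNormsKLevelV1 (geo9K)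
open B9Eq352DivFormLetters (coordEquiv coordEquiv_apply conj conj_apply conj_sub)
open B9Thm37Sum (mulOp mulOp_apply hasMajorant_sandwich_local hasMajorant_localSum)
open B9Thm37CubeCoverCommutators (cutMulY cutMulY_apply)
open B9Thm37GpTorusRegular (conj_one conj_sum conj_smul)
open B9CoReadingCoords (norm_le_basisBound_mul)

variable {d ℓ : ℕ} {hd : 1 ≤ d + 1} {hL : Odd (ℓ + 1) ∧ 1 < ℓ + 1} {b₀ b₁ : ℝ}
variable {𝔸 : Type} [NormedRing 𝔸] [NormedAlgebra ℂ 𝔸] [CompleteSpace 𝔸]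
variable {ι : Type} [Fintype ι]
variable (i : KIdx d ℓ hd hL b₀ b₁) (b : Module.Basis ι ℝ 𝔸)

/-! ## §1 Algebra: (3.96) in fixed-point form, and the cut-offs in real coordinates -/

section Algebra

variable {S : Type}

/-- **(3.96) in fixed-point form, in any ring**: if `T` is a left inverse of `L` and `L·C₀ = 1 − R` ((3.95)), then `T = C₀ + T·R` (the Neumann series
`Σ C₀Rⁿ` of (3.96) is its solution; no series is summed here). [cite: Balaban1985BackgroundPropagators, (3.95)–(3.96) p.411] -/
theorem fixedPoint_of_inv_395 {A : Type*} [Ring A] {L T C0 R : A} (hinv : T * L = 1) (h395 : L * C0 = 1 - R) : T = C0 + T * R := by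
  have h : T * (1 - R) = C0 := by rw [← h395, ← mul_assoc, hinv, one_mul]
  rw [mul_sub, mul_one, sub_eq_iff_eq_add] at h
  exact h

omit [CompleteSpace 𝔸] in
/-- `conj b` is additive. [cite: Balaban1984PropagatorsII, (2.52) p.232, bookkeeping] -/
theorem conj_add (T₁ T₂ : Module.End ℝ (S → 𝔸)) : conj b (T₁ + T₂) = conj b T₁ + conj b T₂ :=
  map_add ((coordEquiv b).conj : Module.End ℝ (S → 𝔸) ≃ₗ[ℝ] Module.End ℝ (S × ι → ℝ)) T₁ T₂

omit [CompleteSpace 𝔸] in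
/-- **(3.96) in real coordinates with a scale weight**: `conj b (s•T) = conj b (s•C₀) + conj b (s•T)·conj b R`.
[cite: Balaban1985BackgroundPropagators, (3.96) p.411; Balaban1984PropagatorsII, (2.52) p.232] -/
theorem conj_scaled_fixedPoint (s : ℝ) {L T C0 R : Module.End ℝ (S → 𝔸)} (hinv : T * L = 1) (h395 : L * C0 = 1 - R) :
    conj b (s • T) = conj b (s • C0) + conj b (s • T) * conj b R := by
  have h := fixedPoint_of_inv_395 hinv h395
  conv_lhs => rw [h]
  rw [smul_add, ← smul_mul_assoc, conj_add, B9Eq352DivFormLetters.conj_mul]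

omit [CompleteSpace 𝔸] in
/-- **`conj b (h·) = mulOp (h ∘ fst)` on any carrier** (M5.5 FILE 1's `conj_cutMulY` was stated at the site carrier; the block carrier needs the same).
[cite: Balaban1985BackgroundPropagators, (3.87) p.409, dictionary] -/
theorem conj_cutMulY (h : S → ℝ) : conj b ((cutMulY (𝔸 := 𝔸) h).restrictScalars ℝ) = mulOp (fun p : S × ι => h p.1) := by
  apply LinearMap.ext
  intro μ
  funext p
  rw [conj_apply, mulOp_apply, LinearMap.restrictScalars_apply, cutMulY_apply, Complex.coe_smul, map_smul, Finsupp.smul_apply, smul_eq_mul,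
    ← coordEquiv_apply, LinearEquiv.apply_symm_apply]

omit [CompleteSpace 𝔸] in
/-- **`Σ_□ h_□² = 1` on 𝔅 as an operator identity** (p. 408 «defined on 𝔅 also»): `Σ_□ M_{h_□}M_{h_□} = 1`. [cite: Balaban1985BackgroundPropagators, p.408] -/
theorem sum_cutMulY_sq {κ : Type} [Fintype κ] (h : κ → S → ℝ) (hsq : ∀ s, ∑ k, h k s ^ 2 = 1) :
    ∑ k, (cutMulY (𝔸 := 𝔸) (h k)).restrictScalars ℝ * (cutMulY (𝔸 := 𝔸) (h k)).restrictScalars ℝ = 1 := by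
  apply LinearMap.ext
  intro Λ
  funext s
  rw [LinearMap.coe_sum, Finset.sum_apply, Finset.sum_apply, Module.End.one_apply]
  simp only [Module.End.mul_apply, LinearMap.restrictScalars_apply, cutMulY_apply, smul_smul]
  rw [← Finset.sum_smul]
  have h1 : ∑ k, ((h k s : ℝ) : ℂ) * ((h k s : ℝ) : ℂ) = 1 := by
    have h2 := hsq s
    simp only [pow_two] at h2
    exact_mod_cast h2
  rw [h1, one_smul]

omit [CompleteSpace 𝔸] in
/-- **(3.95) AT CUT-OFF LETTERS** (r06's ring identity `B9Thm39Sum.eq395_oneSub`, by name): with `L = Q′G′²Q′*`, the local letters `L_□`, the characteristic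
cut-offs `χ̃_□`, the partition `h_□` (`Σ_□ h_□² = 1`) and local inverses `C_□` with the LOCAL INVERSE PROPERTY `M_{h_□}(χ̃_□L_□)C_□M_{h_□} = M_{h_□}²`:
`L·Σ_□ M_{h_□}C_□M_{h_□} = 1 − R`, `R = −(Σ₁ + Σ₂ + Σ₃)` the three sums of (3.95). [cite: Balaban1985BackgroundPropagators, (3.95) p.411] -/
theorem eq395_cutoffs {κ : Type} [Fintype κ] (L : Module.End ℝ (S → 𝔸)) (h : κ → S → ℝ) (hsq : ∀ s, ∑ k, h k s ^ 2 = 1)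
    (Chi Cl Lloc : κ → Module.End ℝ (S → 𝔸))
    (hloc : ∀ k, (cutMulY (𝔸 := 𝔸) (h k)).restrictScalars ℝ * (Chi k * Lloc k) * Cl k * (cutMulY (𝔸 := 𝔸) (h k)).restrictScalars ℝ
      = (cutMulY (𝔸 := 𝔸) (h k)).restrictScalars ℝ * (cutMulY (𝔸 := 𝔸) (h k)).restrictScalars ℝ) :
    L * (∑ k, (cutMulY (𝔸 := 𝔸) (h k)).restrictScalars ℝ * Cl k * (cutMulY (𝔸 := 𝔸) (h k)).restrictScalars ℝ) =
      1 - -(∑ k, (1 - Chi k) * L * ((cutMulY (𝔸 := 𝔸) (h k)).restrictScalars ℝ * Cl k * (cutMulY (𝔸 := 𝔸) (h k)).restrictScalars ℝ) +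
        ∑ k, Chi k * (L - Lloc k) * ((cutMulY (𝔸 := 𝔸) (h k)).restrictScalars ℝ * Cl k * (cutMulY (𝔸 := 𝔸) (h k)).restrictScalars ℝ) +
        ∑ k, (Chi k * Lloc k * (cutMulY (𝔸 := 𝔸) (h k)).restrictScalars ℝ - (cutMulY (𝔸 := 𝔸) (h k)).restrictScalars ℝ * (Chi k * Lloc k)) * Cl k *
          (cutMulY (𝔸 := 𝔸) (h k)).restrictScalars ℝ) :=
  B9Thm39Sum.eq395_oneSub L (fun k => (cutMulY (𝔸 := 𝔸) (h k)).restrictScalars ℝ) Chi Cl Lloc hloc (sum_cutMulY_sq h hsq)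

end Algebra

/-! ## §2 THE GLUE: (3.95) + the given inverse + the two majorants ⇒ the (3.48)-shape majorant of `conj b (s•C(U))` -/

section Glue

variable [DecidableEq ι] [Fintype (geo9K i).Site] [DecidableEq (geo9K i).Site] {Rr : ℝ} {Hp : Prop}
variable (ιB : BlkY i → IBondY i)

omit [CompleteSpace 𝔸] [DecidableEq (geo9K i).Site] in
/-- ★★ **THEOREM 3.9's MECHANISM ⇒ (3.48)-SHAPE MAJORANT FOR `(Q′G′²Q′*)⁻¹(U)`, AT def-Y's BLOCK CARRIER** (p. 411 «(Q′G′²Q′*)⁻¹ = C₀(I − R)⁻¹ = Σ C₀Rⁿ …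
convergent in the weighted supremum norm on 𝔅 appearing in (3.48)»): for ℝ-linear letters `L` (= Q′G′²Q′*), `T` with `T·L = 1` (`hinv`), `C₀`, `R` with
`L·C₀ = 1 − R` ((3.95), `h395`), a majorant `A·P(a)·e^{−r·d(a,a′)}` of `conj b (s•C₀)` ((3.48) for C₀, `hC0`), a majorant `θ·e^{−r·d(a,a′)}` of `conj b R`
((2.85)-shape, `hR`), [4] Lemma 2.1 at `(r, α′)` (`h261`, `h263`, `htri`) and `θc₁(r, α′) < 1` («M sufficiently large»): `conj b (s•T)` has the majorant
`A·c₁(r,α′)(1 − θc₁(r,α′))⁻¹·P(a)·e^{−(1−α′)r·d(a,a′)}` ([4] (2.66)). Block map `(s, j) ↦ ιB s`.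
[cite: Balaban1985BackgroundPropagators, (3.95)–(3.96) p.411 + Thm 3.9 p.413 («This theorem implies Theorem 3.2»); Balaban1984PropagatorsII, (2.66) p.234] -/
theorem hasMajorant_conj_Cinv_of_395 (d' : ℕ) {r α' θ A : ℝ} (P : (geo9K i).Site → ℝ) (s : ℝ)
    {L T C0 Rop : Module.End ℝ (BlkY i → 𝔸)}
    (hA : 0 ≤ A) (hP : ∀ a, 0 ≤ P a) (hθ : 0 ≤ θ) (hαr : 0 ≤ (1 - α') * r)
    (htri : Triangle254 (toB6 (geo9K i) Rr Hp)) (hrefl : ∀ y : (geo9K i).Site, (geo9K i).dist y y = 0)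
    (hdnn : ∀ y y' : (geo9K i).Site, 0 ≤ (geo9K i).dist y y')
    (h261 : Ineq261 d' (toB6 (geo9K i) Rr Hp) r α') (h263 : Ineq263 d' (toB6 (geo9K i) Rr Hp) r α')
    (hsmall : θ * B6.c1 d' r α' < 1)
    (hinv : T * L = 1) (h395 : L * C0 = 1 - Rop)
    (hC0 : HasMajorant (g := toB6 (geo9K i) Rr Hp) (fun p : BlkY i × ι => ιB p.1) (conj b (s • C0))
      (fun a a' => A * P a * Real.exp (-(r * (geo9K i).dist a a'))))
    (hR : HasMajorant (g := toB6 (geo9K i) Rr Hp) (fun p : BlkY i × ι => ιB p.1) (conj b Rop)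
      (fun a a' => θ * Real.exp (-(r * (geo9K i).dist a a')))) :
    HasMajorant (g := toB6 (geo9K i) Rr Hp) (fun p : BlkY i × ι => ιB p.1) (conj b (s • T))
      (fun a a' => A * B6.c1 d' r α' * (1 - θ * B6.c1 d' r α')⁻¹ * P a * Real.exp (-((1 - α') * r * (geo9K i).dist a a'))) :=
  majorant_of_fixedPoint_266 (g := toB6 (geo9K i) Rr Hp) (fun p : BlkY i × ι => ιB p.1) d' r α' θ A P hA hP hθ hαr htri hrefl hdnn h261 h263
    hsmall hC0 hR (conj_scaled_fixedPoint b s hinv h395)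

/-! ## §3 `C₀ = Σ_□ h_□C_□h_□` from the cube letters' localized (3.48) blocks; the three sums add up -/

omit [CompleteSpace 𝔸] [DecidableEq ι] in
/-- ★ **`C₀ = Σ_□ M_{h_□}C_□M_{h_□}` INHERITS THE LOCALIZED (3.48)-MAJORANTS OF THE CUBE LETTERS** (p. 409 «satisfy all the inequalities of Theorems
3.1–3.3», localized by `|h_□| ≤ 1`, `supp h_□ ∩ 𝔅 ⊂ S_□`, overlap `#{□ : a ∈ S_□} ≤ N`): r06's `c0_majorant` at the block map `(s, j) ↦ ιB s`.
[cite: Balaban1985BackgroundPropagators, (3.87) p.409 + Thm 3.2 (3.48) p.398] -/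
theorem hasMajorant_conj_C0_of_cubes {κ : Type} [Fintype κ] (S : κ → Finset (geo9K i).Site) (h : κ → BlkY i → ℝ)
    (Cl : κ → Module.End ℝ (BlkY i → 𝔸)) (s : ℝ) {K : (geo9K i).Site → (geo9K i).Site → ℝ} {N : ℝ}
    (hK : ∀ a a', 0 ≤ K a a') (hh : ∀ k t, |h k t| ≤ 1) (hS : ∀ k t, h k t ≠ 0 → ιB t ∈ S k)
    (hC : ∀ k, HasMajorant (g := toB6 (geo9K i) Rr Hp) (fun p : BlkY i × ι => ιB p.1) (conj b (s • Cl k)) K)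
    (hcnt : ∀ a : (geo9K i).Site, (∑ k, if a ∈ S k then (1 : ℝ) else 0) ≤ N) :
    HasMajorant (g := toB6 (geo9K i) Rr Hp) (fun p : BlkY i × ι => ιB p.1)
      (conj b (s • ∑ k, (cutMulY (𝔸 := 𝔸) (h k)).restrictScalars ℝ * Cl k * (cutMulY (𝔸 := 𝔸) (h k)).restrictScalars ℝ))
      (fun a a' => N * K a a') := by
  have hrw : conj b (s • ∑ k, (cutMulY (𝔸 := 𝔸) (h k)).restrictScalars ℝ * Cl k * (cutMulY (𝔸 := 𝔸) (h k)).restrictScalars ℝ)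
      = ∑ k, mulOp (fun p : BlkY i × ι => h k p.1) * conj b (s • Cl k) * mulOp (fun p : BlkY i × ι => h k p.1) := by
    rw [Finset.smul_sum, conj_sum]
    refine Finset.sum_congr rfl fun k _ => ?_
    rw [← smul_mul_assoc, ← mul_smul_comm, B9Eq352DivFormLetters.conj_mul, B9Eq352DivFormLetters.conj_mul, conj_cutMulY]
  rw [hrw]
  refine hasMajorant_localSum (G := toB6 (geo9K i) Rr Hp) (fun p : BlkY i × ι => ιB p.1) _
    (fun k (a : (geo9K i).Site) => if a ∈ S k then (1 : ℝ) else 0) K N hK (fun k => ?_) hcnt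
  refine hasMajorant_mono (g := toB6 (geo9K i) Rr Hp) _
    (hasMajorant_sandwich_local (R := Rr) (H := Hp) (fun p : BlkY i × ι => ιB p.1) (hC k) (fun p => h k p.1) (fun p => hh k p.1) (S k)
      (fun p hp => hS k p.1 hp)) fun a a' => le_of_eq ?_
  split_ifs <;> simp

omit [CompleteSpace 𝔸] [DecidableEq ι] [DecidableEq (geo9K i).Site] in
/-- **the three sums of (3.95) add up**: majorants `θ_m·e^{−r·d}` of `conj b R_m` (m = 1, 2, 3) give the majorant `(θ₁+θ₂+θ₃)·e^{−r·d}` of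
`conj b (−(R₁ + R₂ + R₃))`'s negative, i.e. of `conj b R` for `R = −(Σ₁+Σ₂+Σ₃)` read as `R₁ + R₂ + R₃` with `R_m := −Σ_m` (r06's `r_majorant_of_three`, any
block map). [cite: Balaban1985BackgroundPropagators, (3.95) p.411; Balaban1984PropagatorsII, (2.85) p.238] -/
theorem hasMajorant_three {r θ₁ θ₂ θ₃ : ℝ} {R₁ R₂ R₃ : Module.End ℝ (BlkY i → 𝔸)}
    (h₁ : HasMajorant (g := toB6 (geo9K i) Rr Hp) (fun p : BlkY i × ι => ιB p.1) (conj b R₁) (fun a a' => θ₁ * Real.exp (-(r * (geo9K i).dist a a'))))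
    (h₂ : HasMajorant (g := toB6 (geo9K i) Rr Hp) (fun p : BlkY i × ι => ιB p.1) (conj b R₂) (fun a a' => θ₂ * Real.exp (-(r * (geo9K i).dist a a'))))
    (h₃ : HasMajorant (g := toB6 (geo9K i) Rr Hp) (fun p : BlkY i × ι => ιB p.1) (conj b R₃) (fun a a' => θ₃ * Real.exp (-(r * (geo9K i).dist a a')))) :
    HasMajorant (g := toB6 (geo9K i) Rr Hp) (fun p : BlkY i × ι => ιB p.1) (conj b (R₁ + R₂ + R₃))
      (fun a a' => (θ₁ + θ₂ + θ₃) * Real.exp (-(r * (geo9K i).dist a a'))) := by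
  rw [conj_add, conj_add]
  refine hasMajorant_mono (g := toB6 (geo9K i) Rr Hp) _ (hasMajorant_add _ (hasMajorant_add _ h₁ h₂) h₃) fun a a' => le_of_eq ?_
  ring

/-! ## §4 ★★ From the per-cube data to the (3.48)-shape majorant of `conj b (s•C(U))` -/

omit [CompleteSpace 𝔸] in
/-- ★★ **THEOREM 3.9 ⇒ THEOREM 3.2's (3.48) BLOCK FOR `C(U) = (Q′G′²Q′*)⁻¹(U)`, AT def-Y's CARRIERS, FROM THE CUBE DATA** (p. 413 «This theorem implies
Theorem 3.2»; p. 411 (3.95)–(3.96)): letters `L` (= Q′G′²Q′*), `T` with `T·L = 1`; the cut-offs `h_□` on 𝔅 (`|h_□| ≤ 1`, `supp h_□ ⊂ S_□` through `ιB`,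
`Σ_□h_□² = 1`, overlap ≤ N); local letters `χ̃_□`, `L_□`, `C_□` with the local inverse property; per-cube (3.48) blocks `A·P(a)e^{−r·d}` of `conj b (s•C_□)`
localized to `S_□` (`hC`); the three sums of (3.95) with (2.85)-shape majorants `θ_m e^{−r·d}` (`hR₁`, `hR₂`, `hR₃` — files F2/F4/F5 of the module);
[4] Lemma 2.1 at `(r, α′)` and `(θ₁+θ₂+θ₃)c₁ < 1` ⟹ `conj b (s•T)` has the majorant `N·A·c₁(1 − (θ₁+θ₂+θ₃)c₁)⁻¹·P(a)·e^{−(1−α′)r·d(a,a′)}`.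
[cite: Balaban1985BackgroundPropagators, Thm 3.9 p.413 + (3.95)–(3.96) p.411 + (3.87) p.409 + Thm 3.2 (3.48) p.398; Balaban1984PropagatorsII, (2.66) p.234] -/
theorem hasMajorant_conj_Cinv_of_cubes (d' : ℕ) {r α' θ₁ θ₂ θ₃ A N : ℝ} (P : (geo9K i).Site → ℝ) (s : ℝ)
    {κ : Type} [Fintype κ] (S : κ → Finset (geo9K i).Site) (h : κ → BlkY i → ℝ)
    {L T : Module.End ℝ (BlkY i → 𝔸)} (Chi Cl Lloc : κ → Module.End ℝ (BlkY i → 𝔸))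
    (hA : 0 ≤ A) (hP : ∀ a, 0 ≤ P a) (hN : 0 ≤ N) (hθ₁ : 0 ≤ θ₁) (hθ₂ : 0 ≤ θ₂) (hθ₃ : 0 ≤ θ₃) (hαr : 0 ≤ (1 - α') * r)
    (htri : Triangle254 (toB6 (geo9K i) Rr Hp)) (hrefl : ∀ y : (geo9K i).Site, (geo9K i).dist y y = 0)
    (hdnn : ∀ y y' : (geo9K i).Site, 0 ≤ (geo9K i).dist y y')
    (h261 : Ineq261 d' (toB6 (geo9K i) Rr Hp) r α') (h263 : Ineq263 d' (toB6 (geo9K i) Rr Hp) r α')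
    (hsmall : (θ₁ + θ₂ + θ₃) * B6.c1 d' r α' < 1)
    (hinv : T * L = 1) (hsq : ∀ t, ∑ k, h k t ^ 2 = 1) (hh : ∀ k t, |h k t| ≤ 1) (hS : ∀ k t, h k t ≠ 0 → ιB t ∈ S k)
    (hcnt : ∀ a : (geo9K i).Site, (∑ k, if a ∈ S k then (1 : ℝ) else 0) ≤ N)
    (hloc : ∀ k, (cutMulY (𝔸 := 𝔸) (h k)).restrictScalars ℝ * (Chi k * Lloc k) * Cl k * (cutMulY (𝔸 := 𝔸) (h k)).restrictScalars ℝ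
      = (cutMulY (𝔸 := 𝔸) (h k)).restrictScalars ℝ * (cutMulY (𝔸 := 𝔸) (h k)).restrictScalars ℝ)
    (hC : ∀ k, HasMajorant (g := toB6 (geo9K i) Rr Hp) (fun p : BlkY i × ι => ιB p.1) (conj b (s • Cl k))
      (fun a a' => if a ∈ S k then A * P a * Real.exp (-(r * (geo9K i).dist a a')) else 0))
    (hR₁ : HasMajorant (g := toB6 (geo9K i) Rr Hp) (fun p : BlkY i × ι => ιB p.1)
      (conj b (-(∑ k, (1 - Chi k) * L * ((cutMulY (𝔸 := 𝔸) (h k)).restrictScalars ℝ * Cl k * (cutMulY (𝔸 := 𝔸) (h k)).restrictScalars ℝ))))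
      (fun a a' => θ₁ * Real.exp (-(r * (geo9K i).dist a a'))))
    (hR₂ : HasMajorant (g := toB6 (geo9K i) Rr Hp) (fun p : BlkY i × ι => ιB p.1)
      (conj b (-(∑ k, Chi k * (L - Lloc k) * ((cutMulY (𝔸 := 𝔸) (h k)).restrictScalars ℝ * Cl k * (cutMulY (𝔸 := 𝔸) (h k)).restrictScalars ℝ))))
      (fun a a' => θ₂ * Real.exp (-(r * (geo9K i).dist a a'))))
    (hR₃ : HasMajorant (g := toB6 (geo9K i) Rr Hp) (fun p : BlkY i × ι => ιB p.1)
      (conj b (-(∑ k, (Chi k * Lloc k * (cutMulY (𝔸 := 𝔸) (h k)).restrictScalars ℝ -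
        (cutMulY (𝔸 := 𝔸) (h k)).restrictScalars ℝ * (Chi k * Lloc k)) * Cl k * (cutMulY (𝔸 := 𝔸) (h k)).restrictScalars ℝ)))
      (fun a a' => θ₃ * Real.exp (-(r * (geo9K i).dist a a')))) :
    HasMajorant (g := toB6 (geo9K i) Rr Hp) (fun p : BlkY i × ι => ιB p.1) (conj b (s • T))
      (fun a a' => N * A * B6.c1 d' r α' * (1 - (θ₁ + θ₂ + θ₃) * B6.c1 d' r α')⁻¹ * P a *
        Real.exp (-((1 - α') * r * (geo9K i).dist a a'))) := by
  have h395 := eq395_cutoffs L h hsq Chi Cl Lloc hloc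
  have hRop : -(∑ k, (1 - Chi k) * L * ((cutMulY (𝔸 := 𝔸) (h k)).restrictScalars ℝ * Cl k * (cutMulY (𝔸 := 𝔸) (h k)).restrictScalars ℝ) +
        ∑ k, Chi k * (L - Lloc k) * ((cutMulY (𝔸 := 𝔸) (h k)).restrictScalars ℝ * Cl k * (cutMulY (𝔸 := 𝔸) (h k)).restrictScalars ℝ) +
        ∑ k, (Chi k * Lloc k * (cutMulY (𝔸 := 𝔸) (h k)).restrictScalars ℝ - (cutMulY (𝔸 := 𝔸) (h k)).restrictScalars ℝ * (Chi k * Lloc k)) * Cl k *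
          (cutMulY (𝔸 := 𝔸) (h k)).restrictScalars ℝ)
      = -(∑ k, (1 - Chi k) * L * ((cutMulY (𝔸 := 𝔸) (h k)).restrictScalars ℝ * Cl k * (cutMulY (𝔸 := 𝔸) (h k)).restrictScalars ℝ)) +
        -(∑ k, Chi k * (L - Lloc k) * ((cutMulY (𝔸 := 𝔸) (h k)).restrictScalars ℝ * Cl k * (cutMulY (𝔸 := 𝔸) (h k)).restrictScalars ℝ)) +
        -(∑ k, (Chi k * Lloc k * (cutMulY (𝔸 := 𝔸) (h k)).restrictScalars ℝ - (cutMulY (𝔸 := 𝔸) (h k)).restrictScalars ℝ * (Chi k * Lloc k)) * Cl k *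
          (cutMulY (𝔸 := 𝔸) (h k)).restrictScalars ℝ) := by
    abel
  rw [hRop] at h395
  have hC0 := hasMajorant_conj_C0_of_cubes i b (Rr := Rr) (Hp := Hp) ιB S h Cl s
    (K := fun a a' => A * P a * Real.exp (-(r * (geo9K i).dist a a')))
    (fun a a' => mul_nonneg (mul_nonneg hA (hP a)) (Real.exp_nonneg _)) hh hS (fun k => ?_) hcnt
  · have hmaj := hasMajorant_conj_Cinv_of_395 i b ιB d' P s (A := N * A) (θ := θ₁ + θ₂ + θ₃) (mul_nonneg hN hA) hP
      (add_nonneg (add_nonneg hθ₁ hθ₂) hθ₃) hαr htri hrefl hdnn h261 h263 hsmall hinv h395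
      (hasMajorant_mono (g := toB6 (geo9K i) Rr Hp) _ hC0 fun a a' => le_of_eq (by ring)) (hasMajorant_three i b ιB hR₁ hR₂ hR₃)
    exact hasMajorant_mono (g := toB6 (geo9K i) Rr Hp) _ hmaj fun a a' => le_of_eq (by ring)
  · -- the localized per-cube block is dominated by the un-localized one (used inside the sandwich, which re-localizes)
    refine hasMajorant_mono (g := toB6 (geo9K i) Rr Hp) _ (hC k) fun a a' => ?_
    split_ifs
    · exact le_rfl
    · exact mul_nonneg (mul_nonneg hA (hP a)) (Real.exp_nonneg _)

end Glue

/-! ## §5 The block-carrier reading: a majorant of `conj b T` bounds `‖(Tλ)(s)‖` for one-block sources ([4] (2.51)) -/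

section Reading

variable [DecidableEq ι] [Fintype (geo9K i).Site] [DecidableEq (geo9K i).Site] {Rr : ℝ} {Hp : Prop}
variable (ιB : BlkY i → IBondY i)

omit [CompleteSpace 𝔸] [DecidableEq ι] [DecidableEq (geo9K i).Site] in
/-- ★ **READING A BLOCK MAJORANT ON THE BLOCK CARRIER** (the block twin of D2's `norm_apply_le_of_hasMajorant_testY`): if `conj b T` has the majorant `K`
for the block map `(s, j) ↦ ιB s`, then for every source `λ` supported at the single block `s′` with `‖λ(s′)‖ ≤ Bλ`, `‖(Tλ)(s)‖ ≤ (Σ_j‖b_j‖)·K(ιB s, ιB s′)·M₂Bλ`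
(`M₂` the coordinate bound of the basis). [cite: Balaban1984PropagatorsII, (2.51) p.232 («|(Tλ)(x)| ≤ K(y,y′)|λ|»); Balaban1985BackgroundPropagators, (3.48) p.398] -/
theorem norm_apply_le_of_hasMajorant_blk (T : Module.End ℝ (BlkY i → 𝔸)) {M₂ : ℝ} (hM₂ : 0 ≤ M₂) (hrepr : ∀ (v : 𝔸) (j : ι), |b.repr v j| ≤ M₂ * ‖v‖)
    {Kmaj : IBondY i → IBondY i → ℝ} (h : HasMajorant (g := toB6 (geo9K i) Rr Hp) (fun p : BlkY i × ι => ιB p.1) (conj b T) Kmaj)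
    (lam : BlkY i → 𝔸) (s' : BlkY i) {Bl : ℝ} (hB : 0 ≤ Bl) (hsupp : ∀ t, t ≠ s' → lam t = 0) (hbd : ‖lam s'‖ ≤ Bl) (t : BlkY i) :
    ‖T lam t‖ ≤ (∑ j, ‖b j‖) * (Kmaj (ιB t) (ιB s') * (M₂ * Bl)) := by
  have hBS : BlockSupp (g := toB6 (geo9K i) Rr Hp) (fun p : BlkY i × ι => ιB p.1) (coordEquiv b lam) (ιB s') (M₂ * Bl) := by
    refine ⟨mul_nonneg hM₂ hB, fun p _ => ?_, fun p hp => ?_⟩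
    · rw [coordEquiv_apply]
      by_cases hp : p.1 = s'
      · calc |b.repr (lam p.1) p.2| ≤ M₂ * ‖lam p.1‖ := hrepr _ _
          _ ≤ M₂ * Bl := mul_le_mul_of_nonneg_left (by rw [hp]; exact hbd) hM₂
      · rw [hsupp p.1 hp, map_zero, Finsupp.zero_apply, abs_zero]
        exact mul_nonneg hM₂ hB
    · have hp' : p.1 ≠ s' := fun h' => hp (by rw [h'])
      rw [coordEquiv_apply, hsupp p.1 hp', map_zero, Finsupp.zero_apply]
  have hco : ∀ j : ι, |b.repr (T lam t) j| ≤ Kmaj (ιB t) (ιB s') * (M₂ * Bl) := by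
    intro j
    have h1 := h _ _ _ hBS (t, j)
    simpa only [conj_apply, LinearEquiv.symm_apply_apply] using h1
  exact norm_le_basisBound_mul b _ hco

omit [CompleteSpace 𝔸] in
/-- ★★ **(3.48)'s PRINTED SHAPE, POINTWISE, FROM THE CUBE DATA**: under the hypotheses of `hasMajorant_conj_Cinv_of_cubes`, for every source `λ` supported at
one block `s′` with `‖λ(s′)‖ ≤ 1`: `s·‖(Tλ)(t)‖ ≤ (Σ_j‖b_j‖)M₂·N·A·c₁(1 − θc₁)⁻¹·P(ιB t)·e^{−(1−α′)r·d(ιB t, ιB s′)}` (`0 ≤ s`) — Theorem 3.2's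
«|(Q′G′²Q′*)⁻¹(y, y′)| ≦ B₀(Lʲη)⁻⁴(L^{j′}η)^{−d}e^{−δ₀d(y,y′)}» with the pairing weight inside the one-block source and `P`, `s` the level/scale weights.
[cite: Balaban1985BackgroundPropagators, Thm 3.2 (3.48) p.398 via Thm 3.9 p.413] -/
theorem norm_Cinv_apply_le_of_cubes {M₂ : ℝ} (hM₂ : 0 ≤ M₂) (hrepr : ∀ (v : 𝔸) (j : ι), |b.repr v j| ≤ M₂ * ‖v‖)
    (d' : ℕ) {r α' θ₁ θ₂ θ₃ A N : ℝ} (P : (geo9K i).Site → ℝ) {s : ℝ} (hs : 0 ≤ s)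
    {κ : Type} [Fintype κ] (S : κ → Finset (geo9K i).Site) (h : κ → BlkY i → ℝ)
    {L T : Module.End ℝ (BlkY i → 𝔸)} (Chi Cl Lloc : κ → Module.End ℝ (BlkY i → 𝔸))
    (hA : 0 ≤ A) (hP : ∀ a, 0 ≤ P a) (hN : 0 ≤ N) (hθ₁ : 0 ≤ θ₁) (hθ₂ : 0 ≤ θ₂) (hθ₃ : 0 ≤ θ₃) (hαr : 0 ≤ (1 - α') * r)
    (htri : Triangle254 (toB6 (geo9K i) Rr Hp)) (hrefl : ∀ y : (geo9K i).Site, (geo9K i).dist y y = 0)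
    (hdnn : ∀ y y' : (geo9K i).Site, 0 ≤ (geo9K i).dist y y')
    (h261 : Ineq261 d' (toB6 (geo9K i) Rr Hp) r α') (h263 : Ineq263 d' (toB6 (geo9K i) Rr Hp) r α')
    (hsmall : (θ₁ + θ₂ + θ₃) * B6.c1 d' r α' < 1)
    (hinv : T * L = 1) (hsq : ∀ t, ∑ k, h k t ^ 2 = 1) (hh : ∀ k t, |h k t| ≤ 1) (hS : ∀ k t, h k t ≠ 0 → ιB t ∈ S k)
    (hcnt : ∀ a : (geo9K i).Site, (∑ k, if a ∈ S k then (1 : ℝ) else 0) ≤ N)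
    (hloc : ∀ k, (cutMulY (𝔸 := 𝔸) (h k)).restrictScalars ℝ * (Chi k * Lloc k) * Cl k * (cutMulY (𝔸 := 𝔸) (h k)).restrictScalars ℝ
      = (cutMulY (𝔸 := 𝔸) (h k)).restrictScalars ℝ * (cutMulY (𝔸 := 𝔸) (h k)).restrictScalars ℝ)
    (hC : ∀ k, HasMajorant (g := toB6 (geo9K i) Rr Hp) (fun p : BlkY i × ι => ιB p.1) (conj b (s • Cl k))
      (fun a a' => if a ∈ S k then A * P a * Real.exp (-(r * (geo9K i).dist a a')) else 0))
    (hR₁ : HasMajorant (g := toB6 (geo9K i) Rr Hp) (fun p : BlkY i × ι => ιB p.1)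
      (conj b (-(∑ k, (1 - Chi k) * L * ((cutMulY (𝔸 := 𝔸) (h k)).restrictScalars ℝ * Cl k * (cutMulY (𝔸 := 𝔸) (h k)).restrictScalars ℝ))))
      (fun a a' => θ₁ * Real.exp (-(r * (geo9K i).dist a a'))))
    (hR₂ : HasMajorant (g := toB6 (geo9K i) Rr Hp) (fun p : BlkY i × ι => ιB p.1)
      (conj b (-(∑ k, Chi k * (L - Lloc k) * ((cutMulY (𝔸 := 𝔸) (h k)).restrictScalars ℝ * Cl k * (cutMulY (𝔸 := 𝔸) (h k)).restrictScalars ℝ))))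
      (fun a a' => θ₂ * Real.exp (-(r * (geo9K i).dist a a'))))
    (hR₃ : HasMajorant (g := toB6 (geo9K i) Rr Hp) (fun p : BlkY i × ι => ιB p.1)
      (conj b (-(∑ k, (Chi k * Lloc k * (cutMulY (𝔸 := 𝔸) (h k)).restrictScalars ℝ -
        (cutMulY (𝔸 := 𝔸) (h k)).restrictScalars ℝ * (Chi k * Lloc k)) * Cl k * (cutMulY (𝔸 := 𝔸) (h k)).restrictScalars ℝ)))
      (fun a a' => θ₃ * Real.exp (-(r * (geo9K i).dist a a'))))
    (lam : BlkY i → 𝔸) (s' : BlkY i) (hsupp : ∀ t, t ≠ s' → lam t = 0) (hbd : ‖lam s'‖ ≤ 1) (t : BlkY i) :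
    s * ‖T lam t‖ ≤ (∑ j, ‖b j‖) * M₂ * (N * A * B6.c1 d' r α' * (1 - (θ₁ + θ₂ + θ₃) * B6.c1 d' r α')⁻¹) * P (ιB t) *
      Real.exp (-((1 - α') * r * (geo9K i).dist (ιB t) (ιB s'))) := by
  have hmaj := hasMajorant_conj_Cinv_of_cubes i b ιB d' P s S h Chi Cl Lloc hA hP hN hθ₁ hθ₂ hθ₃ hαr htri hrefl hdnn h261 h263 hsmall hinv hsq hh hS
    hcnt hloc hC hR₁ hR₂ hR₃
  have hw := norm_apply_le_of_hasMajorant_blk i b ιB (s • T) hM₂ hrepr hmaj lam s' zero_le_one hsupp hbd t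
  rw [LinearMap.smul_apply, Pi.smul_apply, norm_smul, Real.norm_eq_abs, abs_of_nonneg hs] at hw
  exact hw.trans (le_of_eq (by ring))

end Reading

end Literature.MathematicalPhysics.QuantumFieldTheory.Balaban1983to89.B9Thm39CinvTorusRegular

end
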